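import Summits.Ventures.LatticeQCDFlow.Scaling.StarCycleCertificateLaw

/-!
HONEST FRAMING: exact (Metropolis-corrected) sampling algorithms for lattice gauge theory; figures
of merit are autocorrelation/cost numbers at stated couplings and volumes; no continuum-physics
claim.

# StarCycleSupersolution — THE DUAL FORM OF THE REFRESH-CYCLE CERTIFICATE: A NON-NEGATIVE `F` WITH `h·Ψ + M'·F ≤ F` AND `R·F ≤ (1−ρ)·Ψ`
# GIVES `H_n ≤ F` FOR EVERY `n`, HENCE THE ROW INEQUALITY `R·H_n ≤ (1−ρ)·Ψ` OF `StarCycleCertificateLaw` AND ITS LAW (lean-2 GEN-32, ours)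

Venture-side (OURS).  Cell `lqcd-flow` (pub-lqcd), unit `pub-lqcd-lean-2-g32`, 2026-08-29.  Chapter S, file 1.  `StarCycleCertificateLaw` (R9) reduced OPEN-MATH-chapterM
item 1 for `K ≥ 2` to one hypothesis `hcyc : ∀ n a, (R·H_n)(a) ≤ (1−ρ)·Ψ(a)` about the `n`-truncated cycle sums `H_0 = 0`, `H_{n+1} = h·Ψ + M'·H_n` of the synchronous
coupling `Q = h·R + M'` (`h = (1−t)w_0`).  Since `M' ≥ 0`, the sums `H_n` increase to the least non-negative solution of `F = h·Ψ + M'·F`, so `hcyc` holds as soon as SOME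
non-negative `F` satisfies the two pointwise inequalities `h·Ψ + M'·F ≤ F` (super-harmonicity for the chain killed at the redraw) and `R·F ≤ (1−ρ)·Ψ` (contraction seen from
the redraw).  This is the form in which a certificate is searched for (a linear programme on the coupled state space) and checked (finitely many pointwise inequalities,
no recursion in `n`); the exact cycle operator `R·h(1−M')⁻¹Ψ` of the GEN-31 memo is the case of equality.  The companion file `StarSyncIdleBracket` computes `M'·F` for idle
cold levels (the setting of chapter R and of the memo) so that super-harmonicity becomes a finite list of bracket inequalities.  Hypothesis-equations throughout, no definitions,
any finite content space `S`, any entry bijections, any reversible cold kernels.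

## What is proved

* §1 (generic, any finite `Z`): **`cyc_H_le_of_supersolution`** (`M ≥ 0`, `F ≥ 0`, `h·Ψ + M·F ≤ F` ⇒ `H_n ≤ F` for all `n`), **`cyc_hcyc_of_supersolution`** (with `R ≥ 0` and
  `R·F ≤ (1−ρ)·Ψ`: `R·H_n ≤ (1−ρ)·Ψ`).
* §2 (the synchronous coupling, idle cold levels `M_k(u,·) = δ_u` for `k ≥ 1`, exact hot redraws `M_0(u,·) = μ_0`): `pair_pointMass_sum`, `pair_weighted_pointMass_sum`,
  `starSyncSwap_mulVec_bracket`, `idle_coordKernel_eq`, `idle_coordKernel_prod_sum`, `idle_sharedUpdate_sum`, **`starSync_idle_mulVec_apply`** (the `Q·F` formula),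
  **`starSync_idle_rest_mulVec_apply`** (`(M'·F)(a) = Σ_r (t/m)·SW_r(F)(a) + (1−t)(1−w_0)·F(a)`), **`starSync_idle_supersolution_of`** (the bracket form of `h·Ψ + M'·F ≤ F`).
* §3 **`starCycle_worstTvDist_le_of_supersolution`**, **`starCycle_mixingTime_le_of_supersolution`** — R9's two theorems with `hcyc` replaced by a supersolution
  `(F ≥ 0, h·Ψ + M'·F ≤ F, R·F ≤ (1−ρ)·Ψ)` (general cold kernels), and **`starCycle_mixingTime_le_of_idle_supersolution`** — the idle-cold version with the bracket form:
  `t_mix(ε) ≤ ⌈(4/((1−t)w_0·ρ))·log((e·Ψ_max+1)/ε)⌉₊`.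

Reading (no numerics implied): a certificate for item 1 is now a function `F(hub pair, cold pairs)` and two families of linear inequalities; `Scaling/BooleanTwoLevelCertificate`
(this generation) is the first closed instance (`K = 1`).  NOT CLAIMED: any certificate for `K ≥ 2`; anything measured.  Literature grade (cell rule): OWN, elementary; nothing
cited as a fact; no new bib keys.
-/

noncomputable section

open Finset Function Matrix
open Literature.Probability.MarkovChains

namespace Summit.Ventures.LatticeQCDFlow.Scaling

/-! ## §1 Supersolutions dominate the truncated cycle sums -/

section Generic
variable {Z : Type*} [Fintype Z] [DecidableEq Z] {R M : Matrix Z Z ℝ} {h ρ : ℝ} {Ψ F : Z → ℝ}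

omit [DecidableEq Z] in
/-- **`H_n ≤ F` FOR EVERY NON-NEGATIVE SUPERSOLUTION:** if `M ≥ 0` entrywise, `0 ≤ F` and `h·Ψ(z) + (M·F)(z) ≤ F(z)` for every `z`, then the truncated cycle sums
`H_0 = 0`, `H_{n+1} = h·Ψ + M·H_n` satisfy `H_n(z) ≤ F(z)` for all `n, z` (induction; `M` is monotone). [ours] -/
theorem cyc_H_le_of_supersolution (hM0 : ∀ z z', 0 ≤ M z z') (hF0 : ∀ z, 0 ≤ F z) (hFsup : ∀ z, h * Ψ z + (M *ᵥ F) z ≤ F z)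
    {H : ℕ → Z → ℝ} (hH0 : H 0 = 0) (hHs : ∀ n, H (n + 1) = h • Ψ + M *ᵥ H n) (n : ℕ) (z : Z) : H n z ≤ F z := by
  induction n generalizing z with
  | zero => rw [hH0, Pi.zero_apply]; exact hF0 z
  | succ n ih =>
    rw [hHs, Pi.add_apply, Pi.smul_apply, smul_eq_mul]
    have h1 := cyc_mulVec_mono hM0 ih z
    have h2 := hFsup z
    linarith

omit [DecidableEq Z] in
/-- **THE ROW INEQUALITY FROM A SUPERSOLUTION:** under the hypotheses of `cyc_H_le_of_supersolution`, if moreover `R ≥ 0` entrywise and `(R·F)(z) ≤ (1−ρ)·Ψ(z)` for every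
`z`, then `(R·H_n)(z) ≤ (1−ρ)·Ψ(z)` for all `n, z` — the hypothesis `hcyc` of `cyc_coalescence` ∕ `starCycle_worstTvDist_le_of_certificate`. [ours] -/
theorem cyc_hcyc_of_supersolution (hR0 : ∀ z z', 0 ≤ R z z') (hM0 : ∀ z z', 0 ≤ M z z') (hF0 : ∀ z, 0 ≤ F z)
    (hFsup : ∀ z, h * Ψ z + (M *ᵥ F) z ≤ F z) (hRF : ∀ z, (R *ᵥ F) z ≤ (1 - ρ) * Ψ z)
    {H : ℕ → Z → ℝ} (hH0 : H 0 = 0) (hHs : ∀ n, H (n + 1) = h • Ψ + M *ᵥ H n) (n : ℕ) (z : Z) :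
    (R *ᵥ H n) z ≤ (1 - ρ) * Ψ z :=
  (cyc_mulVec_mono hR0 (cyc_H_le_of_supersolution hM0 hF0 hFsup hH0 hHs n) z).trans (hRF z)

end Generic

/-! ## §2 Certificate ⇒ law, supersolution form -/

section Law
variable {K m : ℕ} {S : Type*} [Fintype S] [DecidableEq S] {μ : Fin (K + 1) → S → ℝ} {M : Fin (K + 1) → S → S → ℝ} {w : Fin (K + 1) → ℝ} {t : ℝ}
variable (κ : Fin m → Fin K) (φ : Fin m → S ≃ S)

/-- **SUPERSOLUTION ⇒ `d(n)` BOUND FOR THE PERSISTENT HUB** (all `K`, all finite `S`, all entry bijections; exact hot redraws, reversible row-stochastic cold kernels):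
the hypotheses of `starCycle_worstTvDist_le_of_certificate` with the recursion `H` and `hcyc` replaced by a function `F ≥ 0` on pairs with
`(1−t)w_0·Ψ + M'·F ≤ F` and `R·F ≤ (1−ρ)·Ψ` pointwise ⇒ `d(n) ≤ (1−ρ)^k·Ψ_max + x^{−k}·(1 − h + h·x)ⁿ`, `h = (1−t)w_0`. [ours] -/
theorem starCycle_worstTvDist_le_of_supersolution [Nonempty S] (hm : 1 ≤ m) (ht0 : 0 ≤ t) (ht1 : t ≤ 1) (hw0 : ∀ k, 0 ≤ w k) (hw1 : ∑ k, w k = 1)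
    (hμ : ∀ k x, 0 < μ k x) (hμ1 : ∀ k, ∑ u, μ k u = 1) (hM : ∀ k, IsRowStochastic (M k))
    (hMrev : ∀ k, DetailedBalance (μ k) (M k)) (hM0 : ∀ u v, M 0 u v = μ 0 v)
    {α : Fin m → (Fin (K + 1) → S) → ℝ}
    (hα : ∀ r z, α r z = min 1 (tensorFun μ (edgeFlowSwap (φ r) 0 (κ r).succ z) / tensorFun μ z))
    {Q : (Fin (K + 1) → S) × (Fin (K + 1) → S) → (Fin (K + 1) → S) × (Fin (K + 1) → S) → ℝ}
    (hQ : ∀ a b, Q a b =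
      ∑ r : Fin m, t / m *
        (min (α r a.1) (α r a.2) * (if b.1 = edgeFlowSwap (φ r) 0 (κ r).succ a.1
              ∧ b.2 = edgeFlowSwap (φ r) 0 (κ r).succ a.2 then (1 : ℝ) else 0)
          + (α r a.1 - min (α r a.1) (α r a.2)) * (if b.1 = edgeFlowSwap (φ r) 0 (κ r).succ a.1 ∧ b.2 = a.2
              then (1 : ℝ) else 0)
          + (α r a.2 - min (α r a.1) (α r a.2)) * (if b.1 = a.1 ∧ b.2 = edgeFlowSwap (φ r) 0 (κ r).succ a.2
              then (1 : ℝ) else 0)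
          + (1 - α r a.1 - α r a.2 + min (α r a.1) (α r a.2)) * (if b.1 = a.1 ∧ b.2 = a.2 then (1 : ℝ) else 0))
      + (1 - t) * ∑ k : Fin (K + 1), w k *
        (if a.1 k = a.2 k ∨ k = 0 then
            ∑ v : S, M k (a.1 k) v * (if b.1 = update a.1 k v ∧ b.2 = update a.2 k v then (1 : ℝ) else 0)
          else coordKernel M k a.1 b.1 * coordKernel M k a.2 b.2))
    {R : (Fin (K + 1) → S) × (Fin (K + 1) → S) → (Fin (K + 1) → S) × (Fin (K + 1) → S) → ℝ}
    (hR : ∀ a b, R a b = ∑ v : S, μ 0 v * (if b.1 = update a.1 0 v ∧ b.2 = update a.2 0 v then (1 : ℝ) else 0))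
    {M' : (Fin (K + 1) → S) × (Fin (K + 1) → S) → (Fin (K + 1) → S) × (Fin (K + 1) → S) → ℝ}
    (hM' : ∀ a b, M' a b = Q a b - (1 - t) * w 0 * R a b)
    {ind : (Fin (K + 1) → S) × (Fin (K + 1) → S) → ℝ} (hind : ∀ a, ind a = if a.1 = a.2 then 0 else 1)
    {Ψ : (Fin (K + 1) → S) × (Fin (K + 1) → S) → ℝ} {Ψmax ρ : ℝ} (hΨ0 : ∀ a, 0 ≤ Ψ a) (hΨmax : ∀ a, Ψ a ≤ Ψmax)
    (hΨ1 : ∀ a : (Fin (K + 1) → S) × (Fin (K + 1) → S), (∃ i : Fin K, a.1 i.succ ≠ a.2 i.succ) → 1 ≤ Ψ a) (hρ1 : ρ ≤ 1)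
    {F : (Fin (K + 1) → S) × (Fin (K + 1) → S) → ℝ} (hF0 : ∀ a, 0 ≤ F a)
    (hFsup : ∀ a, (1 - t) * w 0 * Ψ a + (Matrix.mulVec (fun a b => M' a b) F) a ≤ F a)
    (hRF : ∀ a, (Matrix.mulVec (fun a b => R a b) F) a ≤ (1 - ρ) * Ψ a)
    (n k : ℕ) {x : ℝ} (hx0 : 0 < x) (hx1 : x ≤ 1) :
    worstTvDist (fun y z : Fin (K + 1) → S =>
        t * ptGraphSwap μ (fun r : Fin m => (((0 : Fin (K + 1)), (κ r).succ) : Fin (K + 1) × Fin (K + 1))) φ y z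
          + (1 - t) * prodKernel w M y z) (tensorFun μ) n
      ≤ (1 - ρ) ^ k * Ψmax + (x ^ k)⁻¹ * (1 - (1 - t) * w 0 + (1 - t) * w 0 * x) ^ n := by
  -- non-negativity of `M'` and `R` (through the row-stochasticity of the scheme and of `Q`)
  have hP : IsRowStochastic (fun y z : Fin (K + 1) → S =>
      t * ptGraphSwap μ (fun r : Fin m => (((0 : Fin (K + 1)), (κ r).succ) : Fin (K + 1) × Fin (K + 1))) φ y z
        + (1 - t) * prodKernel w M y z) :=
    weightedScheme_isRowStochastic (ptGraphSwap_isRowStochastic hμ) hM hw0 hw1 ht0 ht1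
  have hQc := starSync_isMarkovianCoupling κ φ hm ht0 ht1 hw0 hμ hM hM0 hα hQ
  have hQs : IsRowStochastic Q := hQc.isRowStochastic hP
  obtain ⟨hM'0, -, -⟩ := starSync_rest κ φ ht1 hw0 hμ (hμ1 0) hM hM0 ht0 hα hQ hQs hR hM'
  have hRst := starSync_redraw_isRowStochastic (fun v => (hμ 0 v).le) (hμ1 0) hR
  -- the truncated cycle sums, defined by recursion, and `hcyc` from §1
  let H : ℕ → (Fin (K + 1) → S) × (Fin (K + 1) → S) → ℝ :=
    fun n => Nat.rec (motive := fun _ => (Fin (K + 1) → S) × (Fin (K + 1) → S) → ℝ) 0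
      (fun _ Hn => ((1 - t) * w 0) • Ψ + Matrix.mulVec (fun a b => M' a b) Hn) n
  have hH0 : H 0 = 0 := rfl
  have hHs : ∀ n, H (n + 1) = ((1 - t) * w 0) • Ψ + Matrix.mulVec (fun a b => M' a b) (H n) := fun n => rfl
  have hcyc : ∀ n a, (Matrix.mulVec (fun a b => R a b) (H n)) a ≤ (1 - ρ) * Ψ a := fun n a =>
    cyc_hcyc_of_supersolution (R := fun a b => R a b) (M := fun a b => M' a b) hRst.1 hM'0 hF0 hFsup hRF hH0 hHs n a
  exact starCycle_worstTvDist_le_of_certificate κ φ hm ht0 ht1 hw0 hw1 hμ hμ1 hM hMrev hM0 hα hQ hR hM' hind hΨ0 hΨmax hΨ1 hρ1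
    hH0 hHs hcyc n k hx0 hx1

/-- **SUPERSOLUTION ⇒ MIXING TIME FOR THE PERSISTENT HUB:** the hypotheses of `starCycle_mixingTime_le_of_certificate` with `H`, `hcyc` replaced by a supersolution
`F ≥ 0`, `(1−t)w_0·Ψ + M'·F ≤ F`, `R·F ≤ (1−ρ)·Ψ` (`0 < ρ ≤ 1`, `t < 1`, `w_0 > 0`) ⇒ **`t_mix(ε) ≤ ⌈(4/((1−t)·w_0·ρ))·log((e·Ψ_max + 1)/ε)⌉₊`**. [ours] -/
theorem starCycle_mixingTime_le_of_supersolution [Nonempty S] (hm : 1 ≤ m) (ht0 : 0 ≤ t) (ht1 : t < 1) (hw0 : ∀ k, 0 ≤ w k) (hw00 : 0 < w 0)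
    (hw1 : ∑ k, w k = 1) (hμ : ∀ k x, 0 < μ k x) (hμ1 : ∀ k, ∑ u, μ k u = 1) (hM : ∀ k, IsRowStochastic (M k))
    (hMrev : ∀ k, DetailedBalance (μ k) (M k)) (hM0 : ∀ u v, M 0 u v = μ 0 v)
    {α : Fin m → (Fin (K + 1) → S) → ℝ}
    (hα : ∀ r z, α r z = min 1 (tensorFun μ (edgeFlowSwap (φ r) 0 (κ r).succ z) / tensorFun μ z))
    {Q : (Fin (K + 1) → S) × (Fin (K + 1) → S) → (Fin (K + 1) → S) × (Fin (K + 1) → S) → ℝ}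
    (hQ : ∀ a b, Q a b =
      ∑ r : Fin m, t / m *
        (min (α r a.1) (α r a.2) * (if b.1 = edgeFlowSwap (φ r) 0 (κ r).succ a.1
              ∧ b.2 = edgeFlowSwap (φ r) 0 (κ r).succ a.2 then (1 : ℝ) else 0)
          + (α r a.1 - min (α r a.1) (α r a.2)) * (if b.1 = edgeFlowSwap (φ r) 0 (κ r).succ a.1 ∧ b.2 = a.2
              then (1 : ℝ) else 0)
          + (α r a.2 - min (α r a.1) (α r a.2)) * (if b.1 = a.1 ∧ b.2 = edgeFlowSwap (φ r) 0 (κ r).succ a.2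
              then (1 : ℝ) else 0)
          + (1 - α r a.1 - α r a.2 + min (α r a.1) (α r a.2)) * (if b.1 = a.1 ∧ b.2 = a.2 then (1 : ℝ) else 0))
      + (1 - t) * ∑ k : Fin (K + 1), w k *
        (if a.1 k = a.2 k ∨ k = 0 then
            ∑ v : S, M k (a.1 k) v * (if b.1 = update a.1 k v ∧ b.2 = update a.2 k v then (1 : ℝ) else 0)
          else coordKernel M k a.1 b.1 * coordKernel M k a.2 b.2))
    {R : (Fin (K + 1) → S) × (Fin (K + 1) → S) → (Fin (K + 1) → S) × (Fin (K + 1) → S) → ℝ}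
    (hR : ∀ a b, R a b = ∑ v : S, μ 0 v * (if b.1 = update a.1 0 v ∧ b.2 = update a.2 0 v then (1 : ℝ) else 0))
    {M' : (Fin (K + 1) → S) × (Fin (K + 1) → S) → (Fin (K + 1) → S) × (Fin (K + 1) → S) → ℝ}
    (hM' : ∀ a b, M' a b = Q a b - (1 - t) * w 0 * R a b)
    {ind : (Fin (K + 1) → S) × (Fin (K + 1) → S) → ℝ} (hind : ∀ a, ind a = if a.1 = a.2 then 0 else 1)
    {Ψ : (Fin (K + 1) → S) × (Fin (K + 1) → S) → ℝ} {Ψmax ρ : ℝ} (hΨ0 : ∀ a, 0 ≤ Ψ a) (hΨmax : ∀ a, Ψ a ≤ Ψmax)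
    (hΨ1 : ∀ a : (Fin (K + 1) → S) × (Fin (K + 1) → S), (∃ i : Fin K, a.1 i.succ ≠ a.2 i.succ) → 1 ≤ Ψ a) (hρ0 : 0 < ρ) (hρ1 : ρ ≤ 1)
    {F : (Fin (K + 1) → S) × (Fin (K + 1) → S) → ℝ} (hF0 : ∀ a, 0 ≤ F a)
    (hFsup : ∀ a, (1 - t) * w 0 * Ψ a + (Matrix.mulVec (fun a b => M' a b) F) a ≤ F a)
    (hRF : ∀ a, (Matrix.mulVec (fun a b => R a b) F) a ≤ (1 - ρ) * Ψ a) {ε : ℝ} (hε : 0 < ε) :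
    mixingTime (fun y z : Fin (K + 1) → S =>
        t * ptGraphSwap μ (fun r : Fin m => (((0 : Fin (K + 1)), (κ r).succ) : Fin (K + 1) × Fin (K + 1))) φ y z
          + (1 - t) * prodKernel w M y z) (tensorFun μ) ε
      ≤ ⌈1 / ((1 - t) * w 0 * ρ / 4) * Real.log ((Real.exp 1 * Ψmax + 1) / ε)⌉₊ := by
  have hP : IsRowStochastic (fun y z : Fin (K + 1) → S =>
      t * ptGraphSwap μ (fun r : Fin m => (((0 : Fin (K + 1)), (κ r).succ) : Fin (K + 1) × Fin (K + 1))) φ y z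
        + (1 - t) * prodKernel w M y z) :=
    weightedScheme_isRowStochastic (ptGraphSwap_isRowStochastic hμ) hM hw0 hw1 ht0 ht1.le
  have hQc := starSync_isMarkovianCoupling κ φ hm ht0 ht1.le hw0 hμ hM hM0 hα hQ
  have hQs : IsRowStochastic Q := hQc.isRowStochastic hP
  obtain ⟨hM'0, -, -⟩ := starSync_rest κ φ ht1.le hw0 hμ (hμ1 0) hM hM0 ht0 hα hQ hQs hR hM'
  have hRst := starSync_redraw_isRowStochastic (fun v => (hμ 0 v).le) (hμ1 0) hR
  let H : ℕ → (Fin (K + 1) → S) × (Fin (K + 1) → S) → ℝ :=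
    fun n => Nat.rec (motive := fun _ => (Fin (K + 1) → S) × (Fin (K + 1) → S) → ℝ) 0
      (fun _ Hn => ((1 - t) * w 0) • Ψ + Matrix.mulVec (fun a b => M' a b) Hn) n
  have hH0 : H 0 = 0 := rfl
  have hHs : ∀ n, H (n + 1) = ((1 - t) * w 0) • Ψ + Matrix.mulVec (fun a b => M' a b) (H n) := fun n => rfl
  have hcyc : ∀ n a, (Matrix.mulVec (fun a b => R a b) (H n)) a ≤ (1 - ρ) * Ψ a := fun n a =>
    cyc_hcyc_of_supersolution (R := fun a b => R a b) (M := fun a b => M' a b) hRst.1 hM'0 hF0 hFsup hRF hH0 hHs n a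
  exact starCycle_mixingTime_le_of_certificate κ φ hm ht0 ht1 hw0 hw00 hw1 hμ hμ1 hM hMrev hM0 hα hQ hR hM' hind hΨ0 hΨmax hΨ1 hρ0
    hρ1 hH0 hHs hcyc hε

end Law

end Summit.Ventures.LatticeQCDFlow.Scaling

end
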